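import Literature.Computability.AlgebraicComplexity.HomogeneousComponentsComplexity
import Literature.Computability.AlgebraicComplexity.ConstantFreeValiant
import HarnessLib

/-!
# Homogenisation with formal degree: circuits of formal degree `≤ max (deg f) 1`, size `d² · L(f) + d`

Bürgisser–Clausen–Shokrollahi, *Algebraic Complexity Theory* (1997), §21.2, Lemma (21.25)
(printed p. 550; held scan PDF p. 579, L16–18, page-checked 2026-08-27): the homogeneous parts
`b_i^{(δ)}`, `0 ≤ δ ≤ d`, of the result sequence of a straight-line program of length `L` are
computed by a homogeneous program via `b_i^{(δ)} = b_p^{(δ)} + b_q^{(δ)}` (addition),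
`b_j^{(δ)} = Σ_{u=0}^{δ} b_s^{(u)} b_t^{(δ-u)}` (multiplication), `b_ℓ^{(δ)} = λ b_p^{(δ)}` (scalar
multiplication), "and the constants are free". Bürgisser, *On defining integers …* (Comput.
Complexity 18 (2009) = ECCC TR06-113), §2.2: the FORMAL DEGREE of a circuit (inputs — variables
AND constants — have formal degree `1`, a sum gate the maximum, a product gate the sum of the
formal degrees of its operands; tree: `ArithCircuit.formalDegree`, `ConstantFreeValiant.lean`).

## What is here (all proved; no definitions, no named facts)

The folklore normal form behind "`VP` = polynomial size and polynomial formal degree": a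
fan-in-two circuit computing `f` with `deg f ≤ d` can be rebuilt, at cost `d² · size + d`, into
a circuit of FORMAL degree `≤ max d 1` (`ArithCircuit.exists_eq_formalDegree_le`,
`ArithCircuit.exists_computes_formalDegree_le` with `L(f) ≤ S ⇒ size ≤ d² S + d`, the
`(d + 2)² S + (d + 1)` shape `ArithCircuit.exists_computes_formalDegree_le'` asked for by the
val-lit `BIJL2018_thm6` route memo (brick B5, 2026-08-27), `…_totalDegree`, and the family form
`IsVPFamily.exists_circuits_isPBounded_formalDegree`). The output circuit is well formed, every
gate has EXACTLY two operands, and it works over any commutative semiring and variable type.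

## Why this is not the tree's plain homogenisation pass

`HomogeneousComponentsComplexity.lean` (`ArithCircuit.Homogenisation.hc_*`) runs (21.25) with a
PLAIN output (Jerrum–Snir: all sum weights `1`, constants as input operands) and does not track
formal degrees. In the tree's convention a constant operand has formal degree `1`, so the plain
Cauchy product `Σ_{u=0}^{δ} b_s^{(u)} ⊗ b_t^{(δ-u)}` gives the node of `b_j^{(δ)}` formal degree
`δ + 1` already for inputs `s`, `t`, and the excess compounds along chains of products (for
`(1 + x)^m` computed by `m - 1` multiplications the formal degrees of the plain nodes grow
linearly in `m`). Here the degree-`0` parts — which ARE constants, `b^{(0)} = coeff 0 b` —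
are folded into the WEIGHTS of the sum gates: a product node is rendered as
`b_j^{(δ)} = b_s^{(0)} • b_t^{(δ)} + b_t^{(0)} • b_s^{(δ)} + Σ_{u=1}^{δ-1} b_s^{(u)} ⊗ b_t^{(δ-u)}`
(`FormalHomogenisation.homogeneousComponent_mul_succ`; one weighted sum, then `δ - 1` products
each followed by an addition: `2δ - 1` gates, `Σ_{δ ≤ d} (2δ - 1) = d²` per old product gate), a
weighted-sum node as `a • b_p^{(δ)} + b • b_q^{(δ)}` (`d` gates per old sum gate), so that the
node carrying a component of degree `δ ≥ 1` has formal degree `≤ δ` throughout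
(`FormalHomogenisation.av_gates`); degree-`0` nodes are never built. The output is
`f^{(0)} + f^{(1)} + ⋯ + f^{(d)}` (`d` more gates; the constant `f^{(0)}` enters with formal
degree `1`, whence `max d 1`).

## Design notes

* Bookkeeping = the "growing gate list" plumbing of `HrubesSensitiveMonotoneProofs.lean`
  (`Hrubes2020.operand_eval_of_prefix`, `refsBelow_mono`) extended to formal degrees
  (`FormalHomogenisation.gateFormalDegrees_prefix`, `operand_formalDegree_of_prefix`): the
  availability predicate carries, for each degree `e ∈ [1, d]`, an operand referring backwards
  with the right value AND formal degree `≤ e`; the good-list invariant records fan-in exactly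
  two and backward references (so the result is `WellFormed`).
* Junk gate references of the input circuit (value `0`) homogenise to the constant operand `0`;
  degenerate old gates (`Σ ∅`, `Π ∅`, `Π [u]`, fan-in ≤ 2 is all `IsFanInTwo` asks) cost nothing.
* Constant-freeness is NOT preserved (the new weights are constant terms of intermediate
  results); over `ℤ` with sign constants one would keep the degree-`0` parts as separate
  constant-free subcircuits — not needed by the consumer (circuits over `ZMod p`) and not done.

## References

* [BurgisserClausenShokrollahi1997] P. Bürgisser, M. Clausen, M. A. Shokrollahi, *Algebraic
  Complexity Theory*, Springer 1997, §21.2, Def. (21.23), Lemma (21.25) (printed p. 550).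
* [Burgisser2006] P. Bürgisser, *On defining integers and proving arithmetic circuit lower
  bounds*, ECCC TR06-113 (2006) = Comput. Complexity 18 (2009), §2.2 (formal degree, `VP⁰`).
* [Burgisser2000] P. Bürgisser, *Completeness and Reduction in Algebraic Complexity Theory*,
  Springer 2000, Def. 2.1 (the circuit model `ArithCircuit`).
-/

noncomputable section

namespace Literature.Computability.AlgebraicComplexity

open MvPolynomial

universe u v

namespace ArithCircuit

variable {k : Type u} [CommSemiring k] {σ : Type v}

namespace FormalHomogenisation

/-! ### Plumbing: formal degrees along a growing gate list -/

omit [CommSemiring k] in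
/-- The formal-degree list of a prefix of a gate list is a prefix of the formal-degree list.
[cite: Burgisser2006, §2.2] -/
theorem gateFormalDegrees_prefix {gs gs' : List (Gate k σ)} (h : gs <+: gs') :
    gateFormalDegrees gs <+: gateFormalDegrees gs' := by
  obtain ⟨t, rfl⟩ := h
  induction t using List.reverseRecOn with
  | nil => simp
  | append_singleton t g ih =>
    rw [← List.append_assoc, gateFormalDegrees_append_singleton]
    exact ih.trans (List.prefix_append _ _)

omit [CommSemiring k] in
/-- An operand referring below `degs.length` ignores appended formal degrees.
[cite: Burgisser2006, §2.2] -/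
theorem operand_formalDegree_append {degs ds : List ℕ} {u : Operand k σ}
    (hu : u.RefsBelow degs.length) : u.formalDegree (degs ++ ds) = u.formalDegree degs := by
  cases u with
  | var i => rfl
  | const c => rfl
  | gate j =>
    simp only [Operand.RefsBelow] at hu
    simp [Operand.formalDegree, List.getD_eq_getElem?_getD, List.getElem?_append_left hu]

omit [CommSemiring k] in
/-- An operand referring to gates of `gs` keeps its formal degree when `gs` is extended.
[cite: Burgisser2006, §2.2] -/
theorem operand_formalDegree_of_prefix {gs gs' : List (Gate k σ)} (h : gs <+: gs')
    {u : Operand k σ} (hu : u.RefsBelow gs.length) :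
    u.formalDegree (gateFormalDegrees gs') = u.formalDegree (gateFormalDegrees gs) := by
  obtain ⟨t, ht⟩ := gateFormalDegrees_prefix (k := k) h
  rw [← ht]
  apply operand_formalDegree_append
  rwa [gateFormalDegrees_length]

/-- Availability of the homogeneous components of degrees `1, …, d` of `v`, each by an operand of
formal degree at most its degree, persists when the gate list grows.
[cite: BurgisserClausenShokrollahi1997, Lemma (21.25)] -/
theorem av_mono {gs gs' : List (Gate k σ)} (h : gs <+: gs') {d : ℕ} {v : MvPolynomial σ k}
    (hv : ∀ e, 1 ≤ e → e ≤ d → ∃ u : Operand k σ, u.RefsBelow gs.length ∧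
      u.eval (gateValues gs) = homogeneousComponent e v ∧
      u.formalDegree (gateFormalDegrees gs) ≤ e) :
    ∀ e, 1 ≤ e → e ≤ d → ∃ u : Operand k σ, u.RefsBelow gs'.length ∧
      u.eval (gateValues gs') = homogeneousComponent e v ∧
      u.formalDegree (gateFormalDegrees gs') ≤ e := by
  intro e h1 he
  obtain ⟨u, hu, hval, hdeg⟩ := hv e h1 he
  exact ⟨u, Hrubes2020.refsBelow_mono h.length_le hu,
    (Hrubes2020.operand_eval_of_prefix h hu).trans hval,
    (operand_formalDegree_of_prefix h hu).trans_le hdeg⟩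

/-- Single available operand transported along an extension. [cite: Burgisser2000, Def. 2.1] -/
theorem op_mono {gs gs' : List (Gate k σ)} (h : gs <+: gs') {p : MvPolynomial σ k} {e : ℕ}
    (hp : ∃ u : Operand k σ, u.RefsBelow gs.length ∧ u.eval (gateValues gs) = p ∧
      u.formalDegree (gateFormalDegrees gs) ≤ e) :
    ∃ u : Operand k σ, u.RefsBelow gs'.length ∧ u.eval (gateValues gs') = p ∧
      u.formalDegree (gateFormalDegrees gs') ≤ e := by
  obtain ⟨u, hu, hval, hdeg⟩ := hp
  exact ⟨u, Hrubes2020.refsBelow_mono h.length_le hu,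
    (Hrubes2020.operand_eval_of_prefix h hu).trans hval,
    (operand_formalDegree_of_prefix h hu).trans_le hdeg⟩

/-- The components of positive degree of `0` are the constant operand `0` (formal degree `1`).
[cite: BurgisserClausenShokrollahi1997, Lemma (21.25)] -/
theorem av_zero (gs : List (Gate k σ)) (d : ℕ) :
    ∀ e, 1 ≤ e → e ≤ d → ∃ u : Operand k σ, u.RefsBelow gs.length ∧
      u.eval (gateValues gs) = homogeneousComponent e (0 : MvPolynomial σ k) ∧
      u.formalDegree (gateFormalDegrees gs) ≤ e :=
  fun e h1 _ => ⟨.const 0, trivial, by simp [Operand.eval], by simpa [Operand.formalDegree] using h1⟩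

/-- "The constants are free": the components of positive degree of a constant vanish.
[cite: BurgisserClausenShokrollahi1997, Lemma (21.25)] -/
theorem av_C (gs : List (Gate k σ)) (d : ℕ) (c : k) :
    ∀ e, 1 ≤ e → e ≤ d → ∃ u : Operand k σ, u.RefsBelow gs.length ∧
      u.eval (gateValues gs) = homogeneousComponent e (C c : MvPolynomial σ k) ∧
      u.formalDegree (gateFormalDegrees gs) ≤ e := by
  intro e h1 _
  refine ⟨.const 0, trivial, ?_, by simpa [Operand.formalDegree] using h1⟩
  rw [homogeneousComponent_of_mem (isHomogeneous_C σ c), if_neg (by omega)]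
  simp [Operand.eval]

/-- The components of positive degree of a variable: the input operand `X i` in degree `1`
(formal degree `1`) and `0` above. [cite: BurgisserClausenShokrollahi1997, Lemma (21.25)] -/
theorem av_X (gs : List (Gate k σ)) (d : ℕ) (i : σ) :
    ∀ e, 1 ≤ e → e ≤ d → ∃ u : Operand k σ, u.RefsBelow gs.length ∧
      u.eval (gateValues gs) = homogeneousComponent e (X i : MvPolynomial σ k) ∧
      u.formalDegree (gateFormalDegrees gs) ≤ e := by
  intro e h1 _
  rw [homogeneousComponent_of_mem (isHomogeneous_X k i)]
  by_cases he : e = 1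
  · subst he
    exact ⟨.var i, trivial, by simp [Operand.eval], by simp [Operand.formalDegree]⟩
  · rw [if_neg he]
    exact ⟨.const 0, trivial, by simp [Operand.eval], by simpa [Operand.formalDegree] using h1⟩

/-- The operand referring to a freshly appended gate has that gate's value.
[cite: Burgisser2000, Def. 2.1] -/
theorem eval_gate_length (gs : List (Gate k σ)) (g : Gate k σ) :
    Operand.eval (gateValues (gs ++ [g])) (Operand.gate gs.length : Operand k σ) =
      g.eval (gateValues gs) := by
  rw [gateValues_append_singleton]
  have hl := gateValues_length (k := k) gs
  simp [Operand.eval, List.getD_eq_getElem?_getD, hl]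

omit [CommSemiring k] in
/-- The operand referring to a freshly appended gate has that gate's formal degree.
[cite: Burgisser2006, §2.2] -/
theorem formalDegree_gate_length (gs : List (Gate k σ)) (g : Gate k σ) :
    Operand.formalDegree (gateFormalDegrees (gs ++ [g])) (Operand.gate gs.length : Operand k σ) =
      g.formalDegree (gateFormalDegrees gs) := by
  rw [gateFormalDegrees_append_singleton]
  have hl := gateFormalDegrees_length (k := k) gs
  simp [Operand.formalDegree, List.getD_eq_getElem?_getD, hl]

omit [CommSemiring k] in
/-- Appending a fan-in-two gate whose operands refer to earlier gates keeps the gate list good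
(every gate has exactly two operands, each referring strictly backwards).
[cite: Burgisser2000, Def. 2.1] -/
theorem good_append {gs : List (Gate k σ)}
    (hgs : ∀ (i : ℕ) (g : Gate k σ), gs[i]? = some g → g.fanIn = 2 ∧ ∀ u ∈ g.args, u.RefsBelow i)
    (g : Gate k σ) (hg : g.fanIn = 2) (hrefs : ∀ u ∈ g.args, u.RefsBelow gs.length) :
    ∀ (i : ℕ) (g' : Gate k σ), (gs ++ [g])[i]? = some g' →
      g'.fanIn = 2 ∧ ∀ u ∈ g'.args, u.RefsBelow i := by
  intro i g' hi
  rw [List.getElem?_append] at hi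
  split_ifs at hi with hlt
  · exact hgs i g' hi
  · have hi' : i - gs.length = 0 ∧ g = g' := by simpa [List.getElem?_cons] using hi
    obtain ⟨h0, rfl⟩ := hi'
    obtain rfl : i = gs.length := by omega
    exact ⟨hg, hrefs⟩

/-- One weighted-sum gate `a • p + b • q` appended at the end; its formal degree is the larger
of the formal degrees of its two operands. [cite: Burgisser2006, §2.2] -/
theorem extend_sum {gs : List (Gate k σ)}
    (hgs : ∀ (i : ℕ) (g : Gate k σ), gs[i]? = some g → g.fanIn = 2 ∧ ∀ u ∈ g.args, u.RefsBelow i)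
    (a b : k) {p q : MvPolynomial σ k} {e : ℕ}
    (hp : ∃ u : Operand k σ, u.RefsBelow gs.length ∧ u.eval (gateValues gs) = p ∧
      u.formalDegree (gateFormalDegrees gs) ≤ e)
    (hq : ∃ u : Operand k σ, u.RefsBelow gs.length ∧ u.eval (gateValues gs) = q ∧
      u.formalDegree (gateFormalDegrees gs) ≤ e) :
    ∃ gs' : List (Gate k σ), gs <+: gs' ∧
      (∀ (i : ℕ) (g : Gate k σ), gs'[i]? = some g → g.fanIn = 2 ∧ ∀ u ∈ g.args, u.RefsBelow i) ∧
      gs'.length = gs.length + 1 ∧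
      ∃ u : Operand k σ, u.RefsBelow gs'.length ∧ u.eval (gateValues gs') = a • p + b • q ∧
        u.formalDegree (gateFormalDegrees gs') ≤ e := by
  obtain ⟨up, hup, rfl, hdp⟩ := hp
  obtain ⟨uq, huq, rfl, hdq⟩ := hq
  refine ⟨gs ++ [Gate.sum [(a, up), (b, uq)]], List.prefix_append _ _,
    good_append hgs _ (by simp [Gate.fanIn, Gate.args]) (by simpa [Gate.args] using ⟨hup, huq⟩),
    by simp, .gate gs.length, by simp [Operand.RefsBelow], ?_, ?_⟩
  · rw [eval_gate_length]
    simp [Gate.eval]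
  · rw [formalDegree_gate_length]
    simp only [Gate.formalDegree, List.map_cons, List.map_nil, List.foldr_cons, List.foldr_nil]
    omega

/-- One product gate `p * q` appended at the end; its formal degree is the sum of the formal
degrees of its two operands. [cite: Burgisser2006, §2.2] -/
theorem extend_prod {gs : List (Gate k σ)}
    (hgs : ∀ (i : ℕ) (g : Gate k σ), gs[i]? = some g → g.fanIn = 2 ∧ ∀ u ∈ g.args, u.RefsBelow i)
    {p q : MvPolynomial σ k} {e₁ e₂ : ℕ}
    (hp : ∃ u : Operand k σ, u.RefsBelow gs.length ∧ u.eval (gateValues gs) = p ∧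
      u.formalDegree (gateFormalDegrees gs) ≤ e₁)
    (hq : ∃ u : Operand k σ, u.RefsBelow gs.length ∧ u.eval (gateValues gs) = q ∧
      u.formalDegree (gateFormalDegrees gs) ≤ e₂) :
    ∃ gs' : List (Gate k σ), gs <+: gs' ∧
      (∀ (i : ℕ) (g : Gate k σ), gs'[i]? = some g → g.fanIn = 2 ∧ ∀ u ∈ g.args, u.RefsBelow i) ∧
      gs'.length = gs.length + 1 ∧
      ∃ u : Operand k σ, u.RefsBelow gs'.length ∧ u.eval (gateValues gs') = p * q ∧
        u.formalDegree (gateFormalDegrees gs') ≤ e₁ + e₂ := by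
  obtain ⟨up, hup, rfl, hdp⟩ := hp
  obtain ⟨uq, huq, rfl, hdq⟩ := hq
  refine ⟨gs ++ [Gate.prod [up, uq]], List.prefix_append _ _,
    good_append hgs _ (by simp [Gate.fanIn, Gate.args]) (by simpa [Gate.args] using ⟨hup, huq⟩),
    by simp, .gate gs.length, by simp [Operand.RefsBelow], ?_, ?_⟩
  · rw [eval_gate_length]
    simp [Gate.eval]
  · rw [formalDegree_gate_length]
    simp only [Gate.formalDegree, List.map_cons, List.map_nil, List.sum_cons, List.sum_nil]
    omega


/-! ### The pass, one old gate at a time -/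

/-- Weighted sums: `(a • v + b • w)^{(e)} = a • v^{(e)} + b • w^{(e)}`, ONE weighted-sum gate per
degree `e = 1, …, d` (the weights absorb the scalars), formal degree `≤ e`.
[cite: BurgisserClausenShokrollahi1997, Lemma (21.25)] -/
theorem av_sum {gs : List (Gate k σ)}
    (hgs : ∀ (i : ℕ) (g : Gate k σ), gs[i]? = some g → g.fanIn = 2 ∧ ∀ u ∈ g.args, u.RefsBelow i)
    {d : ℕ} (a b : k) {v w : MvPolynomial σ k}
    (hv : ∀ e, 1 ≤ e → e ≤ d → ∃ u : Operand k σ, u.RefsBelow gs.length ∧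
      u.eval (gateValues gs) = homogeneousComponent e v ∧
      u.formalDegree (gateFormalDegrees gs) ≤ e)
    (hw : ∀ e, 1 ≤ e → e ≤ d → ∃ u : Operand k σ, u.RefsBelow gs.length ∧
      u.eval (gateValues gs) = homogeneousComponent e w ∧
      u.formalDegree (gateFormalDegrees gs) ≤ e) :
    ∃ gs' : List (Gate k σ), gs <+: gs' ∧
      (∀ (i : ℕ) (g : Gate k σ), gs'[i]? = some g → g.fanIn = 2 ∧ ∀ u ∈ g.args, u.RefsBelow i) ∧
      gs'.length ≤ gs.length + d ∧
      ∀ e, 1 ≤ e → e ≤ d → ∃ u : Operand k σ, u.RefsBelow gs'.length ∧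
        u.eval (gateValues gs') = homogeneousComponent e (a • v + b • w) ∧
        u.formalDegree (gateFormalDegrees gs') ≤ e := by
  have key : ∀ m : ℕ, m ≤ d →
      ∃ gs' : List (Gate k σ), gs <+: gs' ∧
        (∀ (i : ℕ) (g : Gate k σ), gs'[i]? = some g → g.fanIn = 2 ∧ ∀ u ∈ g.args, u.RefsBelow i) ∧
        gs'.length ≤ gs.length + m ∧
        ∀ e, 1 ≤ e → e ≤ m → ∃ u : Operand k σ, u.RefsBelow gs'.length ∧
          u.eval (gateValues gs') = homogeneousComponent e (a • v + b • w) ∧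
          u.formalDegree (gateFormalDegrees gs') ≤ e := by
    intro m
    induction m with
    | zero =>
      intro _
      exact ⟨gs, List.prefix_rfl, hgs, by simp, fun e h1 h0 => by omega⟩
    | succ m ih =>
      intro hm
      obtain ⟨gs₁, hp₁, hg₁, hl₁, hQ₁⟩ := ih (Nat.le_of_succ_le hm)
      obtain ⟨gs₂, hp₂, hg₂, hl₂, u, hu, hval, hdeg⟩ := extend_sum hg₁ a b
        (op_mono hp₁ (hv (m + 1) (by omega) hm)) (op_mono hp₁ (hw (m + 1) (by omega) hm))
      refine ⟨gs₂, hp₁.trans hp₂, hg₂, by omega, fun e h1 he => ?_⟩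
      rcases Nat.lt_succ_iff_lt_or_eq.mp (Nat.lt_succ_of_le he) with he' | rfl
      · exact op_mono hp₂ (hQ₁ e h1 (Nat.lt_succ_iff.mp he'))
      · exact ⟨u, hu, by rw [hval, map_add, map_smul, map_smul], hdeg⟩
  exact key d le_rfl

/-- The Cauchy product in degree `e' + 1`, with the two extreme terms written as scalar
multiplications by the constant terms: `(v w)^{(e'+1)} = v₀ • w^{(e'+1)} + w₀ • v^{(e'+1)} +
Σ_{j < e'} v^{(j+1)} w^{(e'-j)}`. [cite: BurgisserClausenShokrollahi1997, Lemma (21.25)] -/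
theorem homogeneousComponent_mul_succ (v w : MvPolynomial σ k) (e' : ℕ) :
    homogeneousComponent (e' + 1) (v * w) =
      coeff 0 v • homogeneousComponent (e' + 1) w + coeff 0 w • homogeneousComponent (e' + 1) v +
        ∑ j ∈ Finset.range e',
          homogeneousComponent (j + 1) v * homogeneousComponent (e' - j) w := by
  rw [DepthReduction.homogeneousComponent_mul, Finset.sum_range_succ', Finset.sum_range_succ]
  simp only [Nat.add_sub_add_right, Nat.sub_zero, Nat.sub_self, homogeneousComponent_zero,
    smul_eq_C_mul]
  ring

/-- Products, one degree: the component of degree `e' + 1 ≤ d` of `v * w` costs `2 e' + 1`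
fan-in-two gates — one weighted sum `v₀ • w^{(e'+1)} + w₀ • v^{(e'+1)}` for the two extreme
terms of the Cauchy product, then `e'` products `v^{(j+1)} ⊗ w^{(e'-j)}` each followed by an
addition — and every node has formal degree `≤ e' + 1`.
[cite: BurgisserClausenShokrollahi1997, Lemma (21.25)] -/
theorem av_prod_degree {gs gs₁ : List (Gate k σ)} (hp₁ : gs <+: gs₁)
    (hg₁ : ∀ (i : ℕ) (g : Gate k σ), gs₁[i]? = some g → g.fanIn = 2 ∧ ∀ u ∈ g.args, u.RefsBelow i)
    {d : ℕ} {v w : MvPolynomial σ k}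
    (hv : ∀ e, 1 ≤ e → e ≤ d → ∃ u : Operand k σ, u.RefsBelow gs.length ∧
      u.eval (gateValues gs) = homogeneousComponent e v ∧
      u.formalDegree (gateFormalDegrees gs) ≤ e)
    (hw : ∀ e, 1 ≤ e → e ≤ d → ∃ u : Operand k σ, u.RefsBelow gs.length ∧
      u.eval (gateValues gs) = homogeneousComponent e w ∧
      u.formalDegree (gateFormalDegrees gs) ≤ e)
    {e' : ℕ} (he' : e' + 1 ≤ d) :
    ∃ gs₂ : List (Gate k σ), gs₁ <+: gs₂ ∧
      (∀ (i : ℕ) (g : Gate k σ), gs₂[i]? = some g → g.fanIn = 2 ∧ ∀ u ∈ g.args, u.RefsBelow i) ∧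
      gs₂.length ≤ gs₁.length + (2 * e' + 1) ∧
      ∃ u : Operand k σ, u.RefsBelow gs₂.length ∧
        u.eval (gateValues gs₂) = homogeneousComponent (e' + 1) (v * w) ∧
        u.formalDegree (gateFormalDegrees gs₂) ≤ e' + 1 := by
  -- step 0: the two extreme terms as one weighted sum
  obtain ⟨gs₂, hp₂, hg₂, hl₂, hacc₀⟩ := extend_sum hg₁ (coeff 0 v) (coeff 0 w)
    (op_mono hp₁ (hw (e' + 1) (by omega) he')) (op_mono hp₁ (hv (e' + 1) (by omega) he'))
  -- steps 1 … e': add the middle terms one product at a time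
  have key : ∀ m : ℕ, m ≤ e' →
      ∃ gs₃ : List (Gate k σ), gs₂ <+: gs₃ ∧
        (∀ (i : ℕ) (g : Gate k σ), gs₃[i]? = some g → g.fanIn = 2 ∧ ∀ u ∈ g.args, u.RefsBelow i) ∧
        gs₃.length ≤ gs₂.length + 2 * m ∧
        ∃ u : Operand k σ, u.RefsBelow gs₃.length ∧
          u.eval (gateValues gs₃) =
            coeff 0 v • homogeneousComponent (e' + 1) w + coeff 0 w • homogeneousComponent (e' + 1) v +
              ∑ j ∈ Finset.range m,
                homogeneousComponent (j + 1) v * homogeneousComponent (e' - j) w ∧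
          u.formalDegree (gateFormalDegrees gs₃) ≤ e' + 1 := by
    intro m
    induction m with
    | zero =>
      intro _
      refine ⟨gs₂, List.prefix_rfl, hg₂, by simp, ?_⟩
      simpa using hacc₀
    | succ m ih =>
      intro hm
      obtain ⟨gs₃, hp₃, hg₃, hl₃, hacc⟩ := ih (Nat.le_of_succ_le hm)
      have hp₀₃ : gs <+: gs₃ := hp₁.trans (hp₂.trans hp₃)
      obtain ⟨gs₄, hp₄, hg₄, hl₄, hprod⟩ := extend_prod hg₃
        (op_mono hp₀₃ (hv (m + 1) (by omega) (by omega)))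
        (op_mono hp₀₃ (hw (e' - m) (by omega) (by omega)))
      obtain ⟨u₄, hu₄, hval₄, hdeg₄⟩ := hprod
      obtain ⟨gs₅, hp₅, hg₅, hl₅, u, hu, hval, hdeg⟩ := extend_sum hg₄ (1 : k) (1 : k)
        (op_mono hp₄ hacc) ⟨u₄, hu₄, hval₄, by omega⟩
      refine ⟨gs₅, hp₃.trans (hp₄.trans hp₅), hg₅, by omega, u, hu, ?_, hdeg⟩
      rw [hval, one_smul, one_smul, Finset.sum_range_succ, add_assoc]
  obtain ⟨gs₃, hp₃, hg₃, hl₃, u, hu, hval, hdeg⟩ := key e' le_rfl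
  refine ⟨gs₃, hp₂.trans hp₃, hg₃, by omega, u, hu, ?_, hdeg⟩
  rw [hval, homogeneousComponent_mul_succ]

/-- Products: all components of degrees `1, …, d` of `v * w` cost `Σ_{e ≤ d} (2e - 1) = d²`
fan-in-two gates, node `(·)^{(e)}` of formal degree `≤ e`.
[cite: BurgisserClausenShokrollahi1997, Lemma (21.25)] -/
theorem av_prod {gs : List (Gate k σ)}
    (hgs : ∀ (i : ℕ) (g : Gate k σ), gs[i]? = some g → g.fanIn = 2 ∧ ∀ u ∈ g.args, u.RefsBelow i)
    {d : ℕ} {v w : MvPolynomial σ k}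
    (hv : ∀ e, 1 ≤ e → e ≤ d → ∃ u : Operand k σ, u.RefsBelow gs.length ∧
      u.eval (gateValues gs) = homogeneousComponent e v ∧
      u.formalDegree (gateFormalDegrees gs) ≤ e)
    (hw : ∀ e, 1 ≤ e → e ≤ d → ∃ u : Operand k σ, u.RefsBelow gs.length ∧
      u.eval (gateValues gs) = homogeneousComponent e w ∧
      u.formalDegree (gateFormalDegrees gs) ≤ e) :
    ∃ gs' : List (Gate k σ), gs <+: gs' ∧
      (∀ (i : ℕ) (g : Gate k σ), gs'[i]? = some g → g.fanIn = 2 ∧ ∀ u ∈ g.args, u.RefsBelow i) ∧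
      gs'.length ≤ gs.length + d ^ 2 ∧
      ∀ e, 1 ≤ e → e ≤ d → ∃ u : Operand k σ, u.RefsBelow gs'.length ∧
        u.eval (gateValues gs') = homogeneousComponent e (v * w) ∧
        u.formalDegree (gateFormalDegrees gs') ≤ e := by
  have key : ∀ m : ℕ, m ≤ d →
      ∃ gs' : List (Gate k σ), gs <+: gs' ∧
        (∀ (i : ℕ) (g : Gate k σ), gs'[i]? = some g → g.fanIn = 2 ∧ ∀ u ∈ g.args, u.RefsBelow i) ∧
        gs'.length ≤ gs.length + m ^ 2 ∧
        ∀ e, 1 ≤ e → e ≤ m → ∃ u : Operand k σ, u.RefsBelow gs'.length ∧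
          u.eval (gateValues gs') = homogeneousComponent e (v * w) ∧
          u.formalDegree (gateFormalDegrees gs') ≤ e := by
    intro m
    induction m with
    | zero =>
      intro _
      exact ⟨gs, List.prefix_rfl, hgs, by simp, fun e h1 h0 => by omega⟩
    | succ m ih =>
      intro hm
      obtain ⟨gs₁, hp₁, hg₁, hl₁, hQ₁⟩ := ih (Nat.le_of_succ_le hm)
      obtain ⟨gs₂, hp₂, hg₂, hl₂, u, hu, hval, hdeg⟩ := av_prod_degree hp₁ hg₁ hv hw (e' := m) hm
      have hsq : (m + 1) ^ 2 = m ^ 2 + (2 * m + 1) := by ring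
      refine ⟨gs₂, hp₁.trans hp₂, hg₂, by omega, fun e h1 he => ?_⟩
      rcases Nat.lt_succ_iff_lt_or_eq.mp (Nat.lt_succ_of_le he) with he' | rfl
      · exact op_mono hp₂ (hQ₁ e h1 (Nat.lt_succ_iff.mp he'))
      · exact ⟨u, hu, hval, hdeg⟩
  exact key d le_rfl

/-- Operands of the old circuit: if the positive-degree components of all earlier gate values
are available (with the formal-degree bounds), so are those of the value of any operand — junk
references read `0`. [cite: Burgisser2000, Def. 2.1] -/
theorem av_operand (gs : List (Gate k σ)) (d : ℕ) (vals : List (MvPolynomial σ k))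
    (hvals : ∀ v ∈ vals, ∀ e, 1 ≤ e → e ≤ d → ∃ u : Operand k σ, u.RefsBelow gs.length ∧
      u.eval (gateValues gs) = homogeneousComponent e v ∧
      u.formalDegree (gateFormalDegrees gs) ≤ e)
    (u : Operand k σ) :
    ∀ e, 1 ≤ e → e ≤ d → ∃ u' : Operand k σ, u'.RefsBelow gs.length ∧
      u'.eval (gateValues gs) = homogeneousComponent e (u.eval vals) ∧
      u'.formalDegree (gateFormalDegrees gs) ≤ e := by
  cases u with
  | var i => exact av_X gs d i
  | const c => exact av_C gs d c
  | gate j =>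
    simp only [Operand.eval, List.getD_eq_getElem?_getD]
    cases hj : vals[j]? with
    | none => exact av_zero gs d
    | some v => exact hvals v (List.mem_of_getElem? hj)

/-- One old fan-in-two gate (a weighted sum of, or a product of, at most two operands): at most
`d²` new fan-in-two gates make all positive-degree components `≤ d` of its value available,
node of degree `e` with formal degree `≤ e` (`d` gates for a weighted sum, `d²` for a product,
none for the degenerate gates `Σ ∅ = 0`, `Π ∅ = 1`, `Π [u] = u`).
[cite: BurgisserClausenShokrollahi1997, Lemma (21.25)] -/
theorem av_gate {gs : List (Gate k σ)}
    (hgs : ∀ (i : ℕ) (g : Gate k σ), gs[i]? = some g → g.fanIn = 2 ∧ ∀ u ∈ g.args, u.RefsBelow i)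
    {d : ℕ} (vals : List (MvPolynomial σ k))
    (hvals : ∀ v ∈ vals, ∀ e, 1 ≤ e → e ≤ d → ∃ u : Operand k σ, u.RefsBelow gs.length ∧
      u.eval (gateValues gs) = homogeneousComponent e v ∧
      u.formalDegree (gateFormalDegrees gs) ≤ e)
    (g : Gate k σ) (hg : g.fanIn ≤ 2) :
    ∃ gs' : List (Gate k σ), gs <+: gs' ∧
      (∀ (i : ℕ) (g : Gate k σ), gs'[i]? = some g → g.fanIn = 2 ∧ ∀ u ∈ g.args, u.RefsBelow i) ∧
      gs'.length ≤ gs.length + d ^ 2 ∧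
      ∀ e, 1 ≤ e → e ≤ d → ∃ u : Operand k σ, u.RefsBelow gs'.length ∧
        u.eval (gateValues gs') = homogeneousComponent e (g.eval vals) ∧
        u.formalDegree (gateFormalDegrees gs') ≤ e := by
  have hdd : d ≤ d ^ 2 := Nat.le_self_pow two_ne_zero d
  have h0 : gs.length ≤ gs.length + d ^ 2 := Nat.le_add_right _ _
  cases g with
  | sum args =>
    match args, hg with
    | [], _ =>
      refine ⟨gs, List.prefix_rfl, hgs, h0, ?_⟩
      rw [show (Gate.sum ([] : List (k × Operand k σ))).eval vals = 0 by simp [Gate.eval]]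
      exact av_zero gs d
    | [a], _ =>
      obtain ⟨gs₁, hp₁, hg₁, hl₁, hr₁⟩ :=
        av_sum hgs a.1 (0 : k) (av_operand gs d vals hvals a.2) (av_zero gs d)
      refine ⟨gs₁, hp₁, hg₁, by omega, ?_⟩
      rw [show (Gate.sum [a]).eval vals = a.1 • a.2.eval vals + (0 : k) • (0 : MvPolynomial σ k) by
        simp [Gate.eval]]
      exact hr₁
    | [a, b], _ =>
      obtain ⟨gs₁, hp₁, hg₁, hl₁, hr₁⟩ :=
        av_sum hgs a.1 b.1 (av_operand gs d vals hvals a.2) (av_operand gs d vals hvals b.2)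
      refine ⟨gs₁, hp₁, hg₁, by omega, ?_⟩
      rw [show (Gate.sum [a, b]).eval vals = a.1 • a.2.eval vals + b.1 • b.2.eval vals by
        simp [Gate.eval]]
      exact hr₁
    | _ :: _ :: _ :: _, hg => simp [Gate.fanIn, Gate.args] at hg
  | prod args =>
    match args, hg with
    | [], _ =>
      refine ⟨gs, List.prefix_rfl, hgs, h0, ?_⟩
      rw [show (Gate.prod ([] : List (Operand k σ))).eval vals = C 1 by simp [Gate.eval]]
      exact av_C gs d 1
    | [u], _ =>
      refine ⟨gs, List.prefix_rfl, hgs, h0, ?_⟩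
      rw [show (Gate.prod [u]).eval vals = u.eval vals by simp [Gate.eval]]
      exact av_operand gs d vals hvals u
    | [u, w], _ =>
      obtain ⟨gs₁, hp₁, hg₁, hl₁, hr₁⟩ :=
        av_prod hgs (av_operand gs d vals hvals u) (av_operand gs d vals hvals w)
      refine ⟨gs₁, hp₁, hg₁, hl₁, ?_⟩
      rw [show (Gate.prod [u, w]).eval vals = u.eval vals * w.eval vals by simp [Gate.eval]]
      exact hr₁
    | _ :: _ :: _ :: _, hg => simp [Gate.fanIn, Gate.args] at hg

/-- **The pass.** For a list `cs` of fan-in-two gates there is a list of at most `d² · |cs|`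
gates, each with exactly two operands referring backwards, in which every homogeneous component
of degree `e ∈ [1, d]` of every value of `cs` is available by an operand of formal degree `≤ e`.
[cite: BurgisserClausenShokrollahi1997, Lemma (21.25)] -/
theorem av_gates (d : ℕ) (cs : List (Gate k σ)) (hcs : ∀ g ∈ cs, g.fanIn ≤ 2) :
    ∃ gs' : List (Gate k σ),
      (∀ (i : ℕ) (g : Gate k σ), gs'[i]? = some g → g.fanIn = 2 ∧ ∀ u ∈ g.args, u.RefsBelow i) ∧
      gs'.length ≤ d ^ 2 * cs.length ∧
      ∀ v ∈ gateValues cs, ∀ e, 1 ≤ e → e ≤ d → ∃ u : Operand k σ, u.RefsBelow gs'.length ∧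
        u.eval (gateValues gs') = homogeneousComponent e v ∧
        u.formalDegree (gateFormalDegrees gs') ≤ e := by
  induction cs using List.reverseRecOn with
  | nil => exact ⟨[], by simp, by simp, fun v hv => by simp [gateValues] at hv⟩
  | append_singleton cs g ih =>
    obtain ⟨gs₁, hg₁, hl₁, hr₁⟩ := ih (fun g' hg' => hcs g' (by simp [hg']))
    obtain ⟨gs₂, hp₂, hg₂, hl₂, hr₂⟩ := av_gate hg₁ (gateValues cs) hr₁ g (hcs g (by simp))
    refine ⟨gs₂, hg₂, ?_, ?_⟩
    · calc gs₂.length ≤ gs₁.length + d ^ 2 := hl₂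
        _ ≤ d ^ 2 * cs.length + d ^ 2 := Nat.add_le_add_right hl₁ _
        _ = d ^ 2 * (cs ++ [g]).length := by simp [Nat.mul_succ]
    · intro v hv
      rw [gateValues_append_singleton, List.mem_append, List.mem_singleton] at hv
      rcases hv with hv | rfl
      · exact av_mono hp₂ (hr₁ v hv)
      · exact hr₂

/-- `Σ_{i ≤ d} f^{(i)} = f` whenever `deg f ≤ d` (the components above the degree vanish;
Mathlib's `sum_homogeneousComponent` is the case `d = deg f`). [folklore] -/
private theorem sum_homogeneousComponent_of_totalDegree_le (f : MvPolynomial σ k) {d : ℕ}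
    (hd : f.totalDegree ≤ d) :
    ∑ i ∈ Finset.range (d + 1), homogeneousComponent i f = f := by
  induction d with
  | zero =>
    rw [Finset.sum_range_one, homogeneousComponent_zero]
    exact (totalDegree_eq_zero_iff_eq_C.mp (Nat.le_zero.mp hd)).symm
  | succ d ih =>
    rcases Nat.lt_or_ge f.totalDegree (d + 1) with h | h
    · rw [Finset.sum_range_succ, ih (Nat.lt_succ_iff.mp h), homogeneousComponent_eq_zero _ _ h,
        add_zero]
    · rw [show d + 1 = f.totalDegree by omega]
      exact sum_homogeneousComponent f

end FormalHomogenisation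

/-! ### Main results -/

/-- **Homogenisation with formal degree.** Every fan-in-two circuit `P` (weighted sums and
products, any commutative semiring, junk references allowed) whose value has total degree `≤ d`
can be replaced by a well-formed circuit with the SAME value in which every gate has exactly
two operands, of size at most `d² · |P| + d` and FORMAL DEGREE at most `max d 1`: homogenise
gate by gate as in BCS Lemma (21.25), folding the degree-`0` components (constants) into the
weights of sum gates so that the node carrying a component of degree `e ≥ 1` has formal degree
`≤ e` (in the tree's convention constants have formal degree `1`, so the plain Cauchy product
would not do), then add up the components `f^{(0)} + f^{(1)} + ⋯ + f^{(d)}` of the output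
(`d` more gates). [cite: BurgisserClausenShokrollahi1997, Lemma (21.25)]
[cite: Burgisser2006, §2.2] -/
theorem exists_eq_formalDegree_le (P : ArithCircuit k σ) (hP : P.IsFanInTwo) {d : ℕ}
    (hd : P.eval.totalDegree ≤ d) :
    ∃ Q : ArithCircuit k σ, (∀ g ∈ Q.gates, g.fanIn = 2) ∧ Q.WellFormed ∧ Q.eval = P.eval ∧
      Q.size ≤ d ^ 2 * P.size + d ∧ Q.formalDegree ≤ max d 1 := by
  obtain ⟨gs, hgood, hlen, hav⟩ := FormalHomogenisation.av_gates d P.gates hP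
  have hout := FormalHomogenisation.av_operand gs d (gateValues P.gates) hav P.output
  have key : ∀ m : ℕ, m ≤ d →
      ∃ gs' : List (Gate k σ), gs <+: gs' ∧
        (∀ (i : ℕ) (g : Gate k σ), gs'[i]? = some g → g.fanIn = 2 ∧ ∀ u ∈ g.args, u.RefsBelow i) ∧
        gs'.length ≤ gs.length + m ∧
        ∃ u : Operand k σ, u.RefsBelow gs'.length ∧
          u.eval (gateValues gs') = ∑ i ∈ Finset.range (m + 1), homogeneousComponent i P.eval ∧
          u.formalDegree (gateFormalDegrees gs') ≤ max m 1 := by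
    intro m
    induction m with
    | zero =>
      intro _
      refine ⟨gs, List.prefix_rfl, hgood, by simp, .const (coeff 0 P.eval), trivial, ?_, ?_⟩
      · simp [Operand.eval, homogeneousComponent_zero]
      · simp [Operand.formalDegree]
    | succ m ih =>
      intro hm
      obtain ⟨gs₁, hp₁, hg₁, hl₁, u₁, hu₁, hval₁, hdeg₁⟩ := ih (Nat.le_of_succ_le hm)
      obtain ⟨gs₂, hp₂, hg₂, hl₂, u, hu, hval, hdeg⟩ :=
        FormalHomogenisation.extend_sum hg₁ (1 : k) (1 : k) (e := m + 1)
          ⟨u₁, hu₁, hval₁, hdeg₁.trans (by omega)⟩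
          (FormalHomogenisation.op_mono hp₁ (hout (m + 1) (by omega) hm))
      refine ⟨gs₂, hp₁.trans hp₂, hg₂, by omega, u, hu, ?_, hdeg.trans (le_max_left _ _)⟩
      rw [hval, one_smul, one_smul, Finset.sum_range_succ _ (m + 1)]
      rfl
  obtain ⟨gs', -, hg', hl', u, hu, hval, hdeg⟩ := key d le_rfl
  refine ⟨⟨gs', u⟩, fun g hg => ?_, ⟨fun i g hi => (hg' i g hi).2, hu⟩, ?_, ?_, hdeg⟩
  · obtain ⟨i, hi⟩ := List.mem_iff_getElem?.mp hg
    exact (hg' i g hi).1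
  · show u.eval (gateValues gs') = P.eval
    rw [hval, FormalHomogenisation.sum_homogeneousComponent_of_totalDegree_le _ hd]
  · show gs'.length ≤ d ^ 2 * P.gates.length + d
    omega

/-- **Circuits of formal degree `≤ deg f`, size `d² · L(f) + d`.** If `L(f) ≤ S` (fan-in-two
complexity `complexity`) and `deg f ≤ d`, then `f` is computed by a well-formed circuit in which
every gate has exactly two operands, of size `≤ d² · S + d` and formal degree `≤ max d 1`
(any commutative semiring; the weights of the sum gates and the constant operands of the new
circuit are constant terms of intermediate results of an optimal circuit, so constant-freeness
is NOT preserved). [cite: BurgisserClausenShokrollahi1997, Lemma (21.25)]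
[cite: Burgisser2006, §2.2] -/
theorem exists_computes_formalDegree_le (f : MvPolynomial σ k) {S d : ℕ}
    (hS : complexity f ≤ S) (hd : f.totalDegree ≤ d) :
    ∃ P : ArithCircuit k σ, (∀ g ∈ P.gates, g.fanIn = 2) ∧ P.IsFanInTwo ∧ P.WellFormed ∧
      P.Computes f ∧ P.size ≤ d ^ 2 * S + d ∧ P.formalDegree ≤ max d 1 := by
  obtain ⟨P₀, h2, hf, hsize⟩ := exists_computes_size_eq_complexity f
  rw [Computes] at hf
  obtain ⟨Q, hfan, hwf, heval, hQsize, hdeg⟩ := exists_eq_formalDegree_le P₀ h2 (d := d) (hf ▸ hd)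
  refine ⟨Q, hfan, fun g hg => (hfan g hg).le, hwf, heval.trans hf, ?_, hdeg⟩
  calc Q.size ≤ d ^ 2 * P₀.size + d := hQsize
    _ ≤ d ^ 2 * S + d := by rw [hsize]; exact Nat.add_le_add_right (Nat.mul_le_mul_left _ hS) _

/-- The same in the shape of the `BIJL2018_thm6` route memo (val-lit, 2026-08-27, brick B5):
`complexity f ≤ S → f.totalDegree ≤ k → ∃ P, P.IsFanInTwo ∧ P.Computes f ∧
P.size ≤ (k + 2)² · S + (k + 1) ∧ P.formalDegree ≤ max k 1`.
[cite: BurgisserClausenShokrollahi1997, Lemma (21.25)] [cite: Burgisser2006, §2.2] -/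
theorem exists_computes_formalDegree_le' (f : MvPolynomial σ k) {S d : ℕ}
    (hS : complexity f ≤ S) (hd : f.totalDegree ≤ d) :
    ∃ P : ArithCircuit k σ, P.IsFanInTwo ∧ P.Computes f ∧
      P.size ≤ (d + 2) ^ 2 * S + (d + 1) ∧ P.formalDegree ≤ max d 1 := by
  obtain ⟨P, -, h2, -, hf, hsize, hdeg⟩ := exists_computes_formalDegree_le f hS hd
  refine ⟨P, h2, hf, hsize.trans ?_, hdeg⟩
  have h1 : d ^ 2 * S ≤ (d + 2) ^ 2 * S :=
    Nat.mul_le_mul_right _ (Nat.pow_le_pow_left (Nat.le_add_right d 2) 2)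
  omega

/-- The case `d = deg f`: a circuit of formal degree at most `max (deg f) 1` and size at most
`(deg f)² · L(f) + deg f`. [cite: BurgisserClausenShokrollahi1997, Lemma (21.25)]
[cite: Burgisser2006, §2.2] -/
theorem exists_computes_formalDegree_le_totalDegree (f : MvPolynomial σ k) :
    ∃ P : ArithCircuit k σ, (∀ g ∈ P.gates, g.fanIn = 2) ∧ P.IsFanInTwo ∧ P.WellFormed ∧
      P.Computes f ∧ P.size ≤ f.totalDegree ^ 2 * complexity f + f.totalDegree ∧
      P.formalDegree ≤ max f.totalDegree 1 :=
  exists_computes_formalDegree_le f le_rfl le_rfl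

end ArithCircuit

/-! ### Families: `VP` has circuits of polynomially bounded size and formal degree -/

section Families

variable {k : Type u} [CommSemiring k] {ς : ℕ → Type v} [∀ n, Fintype (ς n)]

/-- **`VP` families are computed by fan-in-two circuits of polynomially bounded size AND
polynomially bounded formal degree** (formal degree `≤ max (deg f_n) 1`, size
`≤ (deg f_n)² · L(f_n) + deg f_n`): the easy direction of the characterisation of `VP` by size
and formal degree, via `ArithCircuit.exists_computes_formalDegree_le_totalDegree`.
[cite: BurgisserClausenShokrollahi1997, Lemma (21.25)] [cite: Burgisser2006, §2.2] -/
theorem IsVPFamily.exists_circuits_isPBounded_formalDegree {f : ∀ n, MvPolynomial (ς n) k}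
    (hf : IsVPFamily f) :
    ∃ C : ∀ n, ArithCircuit k (ς n),
      (∀ n, (C n).IsFanInTwo ∧ (C n).WellFormed ∧ (C n).Computes (f n) ∧
        (C n).formalDegree ≤ max (f n).totalDegree 1) ∧
      IsPBounded (fun n => (C n).size) ∧ IsPBounded fun n => (C n).formalDegree := by
  choose C hC using fun n => ArithCircuit.exists_computes_formalDegree_le_totalDegree (f n)
  refine ⟨C, fun n => ⟨(hC n).2.1, (hC n).2.2.1, (hC n).2.2.2.1, (hC n).2.2.2.2.2⟩, ?_, ?_⟩
  · refine IsPBounded.mono (IsPBounded.add_holds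
      (IsPBounded.mul_holds (IsPBounded.pow_holds hf.1.2 2) hf.2) hf.1.2) fun n => ?_
    exact (hC n).2.2.2.2.1
  · refine IsPBounded.mono (IsPBounded.add_holds hf.1.2 (IsPBounded.const 1)) fun n => ?_
    have h := (hC n).2.2.2.2.2
    show (C n).formalDegree ≤ (f n).totalDegree + 1
    omega

end Families

end Literature.Computability.AlgebraicComplexity
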